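import Literature.NumberTheory.EllipticCurves.Rank1Residual.Predicates
import Literature.NumberTheory.EllipticCurves.Kobayashi2003.SignedSelmer
import Literature.NumberTheory.EllipticCurves.KatoFineSelmerDualMuProofs
import Literature.NumberTheory.EllipticCurves.BSDQuadraticDescentCasselsPairingProofs
import Mathlib.Algebra.Module.CharacterModule
import HarnessLib

/-!
# Pontryagin step for the crux `SignedTransportAtTwo` (stmt-BirchSwinnertonDyer-20333, route `ThetaPartnerAtTwo`, line
# `bridge`): `X^ε/(p)X^ε` finite ⟺ `Sel^ε(E/K_∞)[p]` finite for EVERY signed dual datum, and the algebraic `μ`/torsion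
# stub driven to the SELMER-GROUP level (sel2 ⇒ fin2)
# (lead prover bsd-wall-tp2-p1 g3; `--supports stmt-BirchSwinnertonDyer-20333`; route-independent, closes nothing)

HONEST FRAMING. THEOREMS ONLY; the one research input (`hsel2`) is an explicit hypothesis spelled inline; nothing about
any curve is asserted; BSD is not proved by any of this. No import of any route file.

WHY THIS SHAPE. The registered stub `stub_fin2` of line `bridge` v6 quantifies over Pontryagin-dual DATA `D` (of `W`)
and `D'` (of `A`) — abstract `Λ`-modules with a group isomorphism `toDual : X ≃ Hom(Sel⁺_∞, ℚ/ℤ)` and the two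
compatibilities `toDual_T_smul`, `toDual_C_smul` (`Kobayashi2003.SignedSelmerDualData`, Def. 1.1) — and over
`Module.Finite` instances. Greenberg–Vatsal (p. 3) and B. D. Kim (2009, Prop. 2.10, Cor. 2.13) argue on the SELMER
GROUPS: "`μ = 0` and cotorsion ⟺ `Sel(E/ℚ_∞)[p]` finite". This file proves the Pontryagin step in BOTH directions for
an axiomatic dual (`§1`: `X/(p)X` finite ⟺ `S[p]` finite; `⟸` is the tree's
`IwasawaDual.finite_quotient_pSmul_of_finite_pTorsion`; `⟹` is new: characters of `S[p]` extend to `S` by the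
injectivity of `ℚ/ℤ`, so `Hom(S[p], ℚ/ℤ)` is a quotient of `X/(p)X`, and an abelian group with finitely many characters
is finite because characters separate points, Mathlib `CharacterModule.exists_character_apply_ne_zero_of_ne_zero`)
and concludes (`§2`, `fin2_of_sel2`) that the `D`-free, `γ`-free, instance-free statement

  sel2 : on the theta habitat, along `W[2] ≅ A[2]`, for every cyclotomic `κ`:
         `{s ∈ Sel⁺(A/ℚ_∞) | 2s = 0}` finite ⇒ `{s ∈ Sel⁺(W/ℚ_∞) | 2s = 0}` finite

implies `stub_fin2` verbatim. `sel2` is GV Prop. (2.8) / Kim Prop. 2.9–2.12 READ AT `p = 2` for the `+` condition, now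
literally about the tree's signed Selmer groups `Kobayashi2003.signedSelmerInfty`; unpublished at `2`; a research
hypothesis, not a fact. No sorry; standard axioms.

References: [GreenbergVatsal2000] p. 3 (proof of Thm. (1.4)), Prop. (2.8); [BDKim2009] Prop. 2.10, Cor. 2.13;
[GreenbergLNM1716] §1 p. 60 (`X/𝔪X` ↔ `Sel[𝔪]`); [Kobayashi2003] Def. 1.1.
-/

set_option autoImplicit false
-- D-0017: single-problem summit, so `Summit.BirchSwinnertonDyer.BirchSwinnertonDyer.…` repeats a namespace BY DESIGN.
set_option linter.dupNamespace false

noncomputable section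

open scoped Classical

open WeierstrassCurve NumberField Literature Literature.NumberTheory.EllipticCurves
  Literature.NumberTheory.EllipticCurves.IwasawaAlgebra Literature.NumberTheory.EllipticCurves.Rank1Residual
  Literature.NumberTheory.EllipticCurves.Kobayashi2003 ZpExtension

namespace Summit.BirchSwinnertonDyer.BirchSwinnertonDyer.Theorems.SignedTransportAtTwo

universe u

/-! ## §1. Pontryagin algebra: `X/(p)X` finite ⟹ `S[p]` finite for an axiomatic dual -/

/-- An abelian group with finitely many characters `T →+ ℚ/ℤ` is finite: characters separate points (Mathlib
`CharacterModule.exists_character_apply_ne_zero_of_ne_zero`), so `T` embeds into the character group of its (finite)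
character group. [cite: GreenbergLNM1716, §1 p. 60 (after Conj. 1.3)] -/
theorem finite_of_finite_characterModule (T : Type*) [AddCommGroup T] (h : Finite (T →+ AddCircle (1 : ℚ))) :
    Finite T := by
  haveI := h
  haveI : Finite ((T →+ AddCircle (1 : ℚ)) →+ AddCircle (1 : ℚ)) := finite_addMonoidHom_addCircle _
  refine Finite.of_injective
    (fun t : T ↦ (AddMonoidHom.eval t : (T →+ AddCircle (1 : ℚ)) →+ AddCircle (1 : ℚ))) ?_
  intro t t' h
  by_contra hne
  obtain ⟨c, hc⟩ := CharacterModule.exists_character_apply_ne_zero_of_ne_zero (sub_ne_zero.mpr hne)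
  apply hc
  have := DFunLike.congr_fun h c
  change c t = c t' at this
  change c (t - t') = 0
  rw [map_sub, this, sub_self]

/-- **`X/(p)X` finite ⟹ `S[p]` finite** for an axiomatic Pontryagin dual (`toDual : X ≃ Hom(S, ℚ/ℤ)` bijective,
constants `c ∈ ℤ_p` acting through `ℤ_p → ℤ/p^k` on `p^k`-torsion classes): restriction of characters to
`S[p] = {s | p s = 0}` kills `(p)·X` and is SURJECTIVE onto `Hom(S[p], ℚ/ℤ)` (characters of the subgroup `S[p]` extend
to `S` by the injectivity of `ℚ/ℤ`, Mathlib `CharacterModule.dual_surjective_of_injective`), so `Hom(S[p], ℚ/ℤ)` is a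
quotient of the finite `X/(p)X`, and `S[p]` is finite by `finite_of_finite_characterModule` — the converse of the
tree's `IwasawaDual.finite_quotient_pSmul_of_finite_pTorsion` (Greenberg's "`X/𝔪X` finite ⟺ `Sel[𝔪]` finite", here
for the ideal `(p)`). [cite: GreenbergLNM1716, §1 p. 60 (after Conj. 1.3)] -/
theorem finite_pTorsion_of_finite_quotient_pSmul {p : ℕ} [Fact p.Prime] {S : Type*} [AddCommGroup S]
    {X : Type*} [AddCommGroup X] [Module (PowerSeries ℤ_[p]) X] {toDual : X →+ (S →+ AddCircle (1 : ℚ))}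
    (hbij : Function.Bijective toDual)
    (hC : ∀ (c : ℤ_[p]) (x : X) (s : S) (k : ℕ), p ^ k • s = 0 →
      toDual (PowerSeries.C c • x) s = (PadicInt.toZModPow k c).val • toDual x s)
    (hfin : Finite (X ⧸ (Ideal.span {PowerSeries.C (p : ℤ_[p])} • ⊤ : Submodule (PowerSeries ℤ_[p]) X))) :
    {s : S | p • s = 0}.Finite := by
  -- `S[p]` as a subgroup
  let Tp : AddSubgroup S :=
    { carrier := {s : S | p • s = 0}
      add_mem' := fun {a b} ha hb ↦ by
        change p • (a + b) = 0
        rw [smul_add, ha, hb, add_zero]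
      zero_mem' := smul_zero _
      neg_mem' := fun {a} ha ↦ by
        change p • (-a) = 0
        rw [smul_neg, ha, neg_zero] }
  change (Tp : Set S).Finite
  suffices hT : Finite Tp from Set.toFinite _
  set N : Submodule (PowerSeries ℤ_[p]) X := Ideal.span {PowerSeries.C (p : ℤ_[p])} • ⊤ with hN
  -- restriction of characters to `S[p]`
  let ρ : X → (Tp →+ AddCircle (1 : ℚ)) := fun x ↦ (toDual x).comp Tp.subtype
  -- characters of `N = (p)·X` kill `S[p]`
  have hNann : ∀ z ∈ N, ∀ s : Tp, toDual z (s : S) = 0 := by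
    intro z hz s
    rw [hN] at hz
    refine Submodule.smul_induction_on hz (fun a ha n _ ↦ ?_) (fun a b ha hb ↦ ?_)
    · obtain ⟨r, rfl⟩ := Ideal.mem_span_singleton'.mp ha
      rw [mul_comm, mul_smul, hC (p : ℤ_[p]) (r • n) s 1 (by rw [pow_one]; exact s.2)]
      have h0 : (PadicInt.toZModPow 1 (p : ℤ_[p])).val = 0 := by
        rw [map_natCast, ZMod.val_natCast, pow_one, Nat.mod_self]
      rw [h0, zero_smul]
    · rw [map_add, AddMonoidHom.add_apply, ha, hb, add_zero]
  -- so `ρ` factors through `X ⧸ N`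
  let ρ' : X ⧸ N → (Tp →+ AddCircle (1 : ℚ)) := fun q ↦ Quotient.liftOn' q ρ (by
    intro x y hxy
    have hxyN : x - y ∈ N := (Submodule.quotientRel_def N).mp hxy
    ext s
    change toDual x s = toDual y s
    rw [← sub_eq_zero, ← AddMonoidHom.sub_apply, ← map_sub]
    exact hNann _ hxyN s)
  -- and `ρ` (hence `ρ'`) is surjective: characters of `S[p]` extend to `S`
  have hsurj : Function.Surjective ρ' := by
    intro χ
    obtain ⟨y, hy⟩ := CharacterModule.dual_surjective_of_injective
      (Tp.subtype.toIntLinearMap) (fun a b hab ↦ Subtype.ext hab) χ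
    obtain ⟨x, hx⟩ := hbij.2 y
    refine ⟨Submodule.Quotient.mk x, ?_⟩
    change ρ x = χ
    ext s
    change toDual x (s : S) = χ s
    rw [hx]
    have := DFunLike.congr_fun hy s
    rw [CharacterModule.dual_apply] at this
    exact this
  haveI := hfin
  exact finite_of_finite_characterModule Tp (Finite.of_surjective ρ' hsurj)

/-! ## §2. sel2 ⇒ fin2 at `p = 2`, and the crux BY NAME from sel2 + Kλ2 + V2mt -/

/-- Every class of `Sel⁺(E/K_∞)` is killed by a power of `p` (a class of `H¹(K_∞, E[p^∞])`,
`WeierstrassCurve.exists_pow_smul_subgroupH1_ker_eq_zero`). [cite: Kobayashi2003, Def. 1.1] -/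
theorem exists_pow_smul_signedSelmerInfty_eq_zero {K : Type u} [Field K] [NumberField K] (W : WeierstrassCurve K)
    {p : ℕ} [Fact p.Prime] (κ : ZpExtension K p) (ε : ℤˣ) (s : signedSelmerInfty W κ ε) :
    ∃ k : ℕ, p ^ k • s = 0 := by
  obtain ⟨k, hk⟩ := W.exists_pow_smul_subgroupH1_ker_eq_zero κ (s : W.subgroupH1 p κ.kerSubgroup)
  exact ⟨k, Subtype.ext (by rw [AddSubgroupClass.coe_nsmul]; exact hk)⟩

/-- **Pontryagin duality for a signed dual datum, both directions: `X^ε/(p)X^ε` finite ⟺ `Sel^ε(E/K_∞)[p]` finite**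
(any number field, any prime, any `ℤ_p`-extension, any datum `D : SignedSelmerDualData W κ γ ε`; no finite-generation
hypothesis). [cite: GreenbergLNM1716, §1 p. 60 (after Conj. 1.3)] [cite: Kobayashi2003, Def. 1.1] -/
theorem finite_quotient_augIdealP_iff_finite_pTorsion {K : Type u} [Field K] [NumberField K] {W : WeierstrassCurve K}
    {p : ℕ} [Fact p.Prime] {κ : ZpExtension K p} {γ : Field.absoluteGaloisGroup K} {ε : ℤˣ}
    (D : SignedSelmerDualData W κ γ ε) :
    Finite (D.X ⧸ (augIdealP p • ⊤ : Submodule (IwasawaAlgebra p) D.X)) ↔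
      {s : signedSelmerInfty W κ ε | p • s = 0}.Finite :=
  ⟨fun h ↦ finite_pTorsion_of_finite_quotient_pSmul D.bijective D.toDual_C_smul h,
    fun h ↦ IwasawaDual.finite_quotient_pSmul_of_finite_pTorsion D.bijective D.toDual_C_smul
      (exists_pow_smul_signedSelmerInfty_eq_zero W κ ε) h⟩

/-- **sel2 ⇒ fin2.** If, on the theta habitat and along `W[2] ≅ A[2]`, finiteness of the `2`-torsion of Kobayashi's
signed Selmer GROUP transfers from the CM partner to the curve for every cyclotomic `κ` (binder `hsel2`: GV
Prop. (2.8) / Kim Prop. 2.9–2.12 shape READ AT `2`, on the tree's `signedSelmerInfty`), then for EVERY pair of dual data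
`(D, D')` at any `(κ, γ)` finiteness of `X⁺/2X⁺` transfers — the registered stub `stub_fin2` of line `bridge` v6
verbatim (its `Module.Finite` binders are not used). [cite: GreenbergVatsal2000, p. 3 (proof of Thm. (1.4)) and Prop. (2.8)]
[cite: BDKim2009, Prop. 2.10 and Cor. 2.13] -/
theorem fin2_of_sel2
    (hsel2 :
    ∀ (W : WeierstrassCurve ℚ) [W.IsElliptic] [W.IsGloballyMinimal] (A : WeierstrassCurve ℚ) [A.IsElliptic]
      [A.IsGloballyMinimal], ¬ W.HasCM → W.analyticRank = 0 → GoodSS W 2 → W.frobeniusTrace 2 = 0 →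
      A.HasCM → GoodSS A 2 → A.frobeniusTrace 2 = 0 →
    (∃ e : WeierstrassCurve.geomTorsion W (2 : ℤ) ≃+ WeierstrassCurve.geomTorsion A (2 : ℤ),
      ∀ (σ : Field.absoluteGaloisGroup ℚ) (P : WeierstrassCurve.geomTorsion W (2 : ℤ)), e (σ • P) = σ • e P) →
    ∀ (κ : ZpExtension ℚ 2), κ.IsCyclotomic →
      {s : signedSelmerInfty A κ 1 | (2 : ℕ) • s = 0}.Finite →
      {s : signedSelmerInfty W κ 1 | (2 : ℕ) • s = 0}.Finite) :
    ∀ (W : WeierstrassCurve ℚ) [W.IsElliptic] [W.IsGloballyMinimal] (A : WeierstrassCurve ℚ) [A.IsElliptic]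
      [A.IsGloballyMinimal], ¬ W.HasCM → W.analyticRank = 0 → GoodSS W 2 → W.frobeniusTrace 2 = 0 →
      A.HasCM → GoodSS A 2 → A.frobeniusTrace 2 = 0 →
    (∃ e : WeierstrassCurve.geomTorsion W (2 : ℤ) ≃+ WeierstrassCurve.geomTorsion A (2 : ℤ),
      ∀ (σ : Field.absoluteGaloisGroup ℚ) (P : WeierstrassCurve.geomTorsion W (2 : ℤ)), e (σ • P) = σ • e P) →
    ∀ (κ : ZpExtension ℚ 2) (γ : Field.absoluteGaloisGroup ℚ), κ.IsCyclotomic → κ.IsTopGenerator γ →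
    ∀ (D : SignedSelmerDualData W κ γ 1) (D' : SignedSelmerDualData A κ γ 1)
      [Module.Finite (IwasawaAlgebra 2) D.X] [Module.Finite (IwasawaAlgebra 2) D'.X],
      Finite (D'.X ⧸ (augIdealP 2 • ⊤ : Submodule (IwasawaAlgebra 2) D'.X)) →
      Finite (D.X ⧸ (augIdealP 2 • ⊤ : Submodule (IwasawaAlgebra 2) D.X)) := by
  intro W _ _ A _ _ hcm hr hss ha hAcm hAss hAa hiso κ γ hκ _hγ D D' _ _ hfinA
  have hA : {s : signedSelmerInfty A κ 1 | (2 : ℕ) • s = 0}.Finite :=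
    (finite_quotient_augIdealP_iff_finite_pTorsion D').mp hfinA
  exact (finite_quotient_augIdealP_iff_finite_pTorsion D).mpr
    (hsel2 W A hcm hr hss ha hAcm hAss hAa hiso κ hκ hA)


end Summit.BirchSwinnertonDyer.BirchSwinnertonDyer.Theorems.SignedTransportAtTwo

end
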